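import Literature.RepresentationTheory.BorelWallach2000.U11ContragredientWeights
import Literature.NumberTheory.Automorphic.GKContragredientSubquotient
import HarnessLib

/-!
# The contragredient functor is exact at `U(1,1)`: `Ṽ → Ũ` is onto, `0 → (V/U)~ → Ṽ → Ũ → 0`

Family `hodge`, lane `lit-hodgefound` (foundations library; seat `lit-hodgefound-p39`, generation 31, row g31-#14b); topic
`RepresentationTheory/BorelWallach2000`, namespace `…BorelWallach2000.U11DualWt` (continued).  Sequel of the trunk's
`GKContragredientSubquotient` (restriction `resCarrier : Ṽ → Ũ`, inflation `infCarrier : (V/U)~ → Ṽ`, injectivity of `infCarrier` and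
exactness at `Ṽ`, for any `G`) and of `U11ContragredientWeights` (`Ṽ(c,d) ≅ (V(−c,−d))*`).  Theorems only; 0 `sorry`, no named fact
(net debt 0, D-0026).

## The mathematics

«The results of §II.3 showed that this functor is contravariant and exact» [KnappVogan1995, §VI.2 (before (6.7)); §II.3 Prop. 2.53 (b)]:
for a `(𝔤, K)`-stable `U ⊆ V` the sequence `0 → (V/U)~ → Ṽ → Ũ → 0` of `K`-finite duals is exact.  The only point beyond linear algebra is
the SURJECTIVITY of `Ṽ → Ũ`: a `K`-finite functional on `U` must be extended to a `K`-FINITE functional on `V`.  At `U(1,1)` (where the tree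
has the `K`-type decomposition `V = ⨁ V(a,b)`, `U11WeightDecomposition`) this is done weight by weight: a weight functional `ψ ∈ Ũ(c,d)`
factors through the `(−c,−d)`-component of `U`, which is the restriction of the `(−c,−d)`-component of `V` (`coe_wtProj_sub`: the weight
projections of `U` are those of `V` restricted, `U` being `K`-stable); extend `ψ|_{U(−c,−d)}` linearly to `V(−c,−d)` and precompose with
`pr_{(−c,−d)}` — the result lies in `Ṽ(c,d)` (`U11ContragredientWeights.wtSpaceDualEquivOf`) and restricts to `ψ`.  Since `Ũ = ⨁ Ũ(c,d)`,
`resCarrier` is onto.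

## What is formalised

`mem_wtSpace_sub_iff` (`U(a,b) = U ∩ V(a,b)`), `coe_wtProj_sub` (`pr^U_{(a,b)} = pr^V_{(a,b)}|_U`), `wtProj_apply_of_mem_iSup_ne`,
`exists_resCarrier_eq_of_mem_wtSpace` (weight functionals on `U` lift to weight functionals on `V`), **`resCarrier_surjective`**,
**`shortExact_infCarrier_resCarrier`** (injective · exact · surjective, packaged as a conjunction).  The `(𝔤, K)`-structure on `U` enters only
through its `K`-type decomposition, so the statements take `hU : IsGKModule G11 (σK.subrepresentation U hK) τU` for ANY compatible `𝔤`-data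
`τU` on `U` (e.g. `GKSubmodule.isGKModule_sub`).  NOT here: the character identity `Θ(Ṽ) = Θ(Ũ) + Θ((V/U)~)` (it is `Θ(V)(−c,−d) =
Θ(U)(−c,−d) + Θ(V/U)(−c,−d)`, `U11ContragredientWeights.formalChar_Kfin` with `U11FormalChar.formalChar_eq_add`).

## References

* A. W. Knapp, D. A. Vogan, *Cohomological Induction and Unitary Representations*, Princeton Math. Ser. 45 (1995), §II.3 Prop. 2.53 (b),
  §VI.2 (before (6.7)); §I.3 Prop. 1.18. [KnappVogan1995]
* A. Borel, N. Wallach, *Continuous Cohomology, Discrete Subgroups, and Representations of Reductive Groups*, 2nd ed., Math. Surveys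
  Monogr. 67, AMS (2000), 0 §2.5. [BorelWallach2000]
-/

noncomputable section

namespace Literature.RepresentationTheory.BorelWallach2000

open Literature.Algebra.Lie Literature.Algebra.Lie.ChevalleyEilenberg
open Literature.NumberTheory.Automorphic
open Literature.RepresentationTheory.KonnoKonno2007 Literature.RepresentationTheory.KonnoKonno2007.RealDualPair
open Literature.RepresentationTheory.KonnoKonno2007.RealDualPair.UForm
open U11HolDS

-- Mathlib idiom (as in `GKModules`, `GKCohomology`): commutator bracket on `Module.End` / matrices
attribute [local instance 100] LieRing.ofAssociativeRing

namespace U11DualWt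

open Module
open U11Irred (wtSpace mem_wtSpace)
open U11Weights (wtProj wtProj_mem wtProj_apply_of_mem wtProj_apply_of_mem_ne)
open U11GenDS (wtChar wtChar_apply)
open U11FormalChar (formalChar)

section Sub

variable {V : Type*} [AddCommGroup V] [Module ℂ V] {σK : Representation ℂ G11.maximalCompact V} {σ𝔤 : G11.lie →ₗ⁅ℝ⁆ Module.End ℂ V}
  (hV : IsGKModule G11 σK σ𝔤) (U : Submodule ℂ V) (hK : ∀ k : G11.maximalCompact, U ≤ U.comap (σK k))

/-! ## §1 Weight spaces and weight projections of a `(𝔤, K)`-stable subspace -/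

omit hK in
/-- `U(a,b) = U ∩ V(a,b)`: a vector of `U` has weight `(a,b)` for the restricted action iff it has in `V`. [cite: KnappVogan1995, Prop. 1.18 (b)] -/
theorem mem_wtSpace_sub_iff (hK : ∀ k : G11.maximalCompact, U ≤ U.comap (σK k)) {a b : ℤ} {u : U} :
    u ∈ wtSpace (σK.subrepresentation U hK) a b ↔ (u : V) ∈ wtSpace σK a b := by
  simp only [mem_wtSpace, Subtype.ext_iff, Submodule.coe_smul]
  rfl

omit hK in
include hV in
/-- `pr_{(a,b)}` kills the sum of the other weight spaces. [cite: KnappVogan1995, Prop. 1.18 (a), (1.19)] -/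
theorem wtProj_apply_of_mem_iSup_ne {ab : ℤ × ℤ} {v : V} (hv : v ∈ ⨆ cd : ℤ × ℤ, ⨆ (_ : cd ≠ ab), wtSpace σK cd.1 cd.2) :
    wtProj hV ab v = 0 := by
  refine Submodule.iSup_induction (fun cd : ℤ × ℤ => ⨆ (_ : cd ≠ ab), wtSpace σK cd.1 cd.2) (motive := fun x : V => wtProj hV ab x = 0)
    hv (fun cd x hx => ?_) (map_zero _) fun x y hx hy => by rw [map_add, hx, hy, add_zero]
  refine Submodule.iSup_induction (fun _ : cd ≠ ab => wtSpace σK cd.1 cd.2) (motive := fun x : V => wtProj hV ab x = 0) hx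
    (fun hne y hy => wtProj_apply_of_mem_ne hV hy hne) (map_zero _) fun x y hx hy => by rw [map_add, hx, hy, add_zero]

-- the `(𝔤, K)`-module structure of `U` for the restricted `K`-action and ANY compatible `𝔤`-data `τU` (e.g. `GKSubmodule.subLie`,
-- `GKSubmodule.isGKModule_sub`); only the `K`-type decomposition of `U` is used
variable {τU : G11.lie →ₗ⁅ℝ⁆ Module.End ℂ U} (hU : IsGKModule G11 (σK.subrepresentation U hK) τU)
include hV hU

/-- **The weight projections of `U` are those of `V` restricted**: `(pr^U_{(a,b)} u : V) = pr^V_{(a,b)} u` (`U` is `K`-stable, so the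
weight components of `u ∈ U` lie in `U`, and the decomposition is unique). [cite: KnappVogan1995, Prop. 1.18 (a), (b), (1.19)] -/
theorem coe_wtProj_sub (ab : ℤ × ℤ) (u : U) : ((wtProj hU ab u : U) : V) = wtProj hV ab (u : V) := by
  have hx : ((wtProj hU ab u : U) : V) ∈ wtSpace σK ab.1 ab.2 :=
    (mem_wtSpace_sub_iff U hK).mp (wtProj_mem hU ab u)
  have hrest : (u : V) - ((wtProj hU ab u : U) : V) ∈ ⨆ cd : ℤ × ℤ, ⨆ (_ : cd ≠ ab), wtSpace σK cd.1 cd.2 := by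
    have h := Submodule.mem_map_of_mem (f := U.subtype) (U11Weights.sub_wtProj_mem hU ab u)
    rw [map_sub, Submodule.coe_subtype] at h
    refine (Submodule.map_iSup _ _).le.trans (iSup_le fun cd => (Submodule.map_iSup _ _).le.trans
      (iSup_le fun hne => ?_)) h
    exact (Submodule.map_le_iff_le_comap.mpr fun x hx' => Submodule.mem_comap.mpr ((mem_wtSpace_sub_iff U hK).mp hx')).trans
      (le_iSup_of_le cd (le_iSup_of_le hne le_rfl))
  have h := wtProj_apply_of_mem_iSup_ne hV hrest
  rw [map_sub, wtProj_apply_of_mem hV hx, sub_eq_zero] at h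
  exact h.symm

/-! ## §2 Weight functionals on `U` lift to weight functionals on `V` -/

/-- **Every weight functional on `U` is the restriction of a weight functional on `V` of the same weight** (extend `ψ|_{U(−c,−d)}` linearly
to `V(−c,−d)` and precompose with `pr_{(−c,−d)}`). [cite: KnappVogan1995, §II.3 Prop. 2.53 (b), §I.3 Prop. 1.18] [cite: BorelWallach2000, 0 §2.5] -/
theorem exists_resCarrier_eq_of_mem_wtSpace {c d : ℤ} {ψ : Dual ℂ U} (hψ : ψ ∈ wtSpace (σK.subrepresentation U hK).dual c d) :
    ∃ ℓ : wtSpace σK.dual c d, U.subtype.dualMap (ℓ : Dual ℂ V) = ψ := by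
  -- the inclusion `r : U(−c,−d) ↪ V(−c,−d)` and a left inverse `g`
  let r : wtSpace (σK.subrepresentation U hK) (-c) (-d) →ₗ[ℂ] wtSpace σK (-c) (-d) :=
    { toFun := fun x => ⟨((x : U) : V), (mem_wtSpace_sub_iff U hK).mp x.2⟩
      map_add' := fun _ _ => rfl
      map_smul' := fun _ _ => rfl }
  have hr : LinearMap.ker r = ⊥ := LinearMap.ker_eq_bot.mpr fun x y hxy =>
    Subtype.ext (Subtype.ext (congrArg (fun z : wtSpace σK (-c) (-d) => (z : V)) hxy))
  obtain ⟨g, hg⟩ := LinearMap.exists_leftInverse_of_injective r hr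
  -- `φ₀ := ψ|_{U(−c,−d)} ∘ g` on `V(−c,−d)`, and `ℓ := φ₀ ∘ pr_{(−c,−d)} ∈ V*(c,d)`
  let φ₀ : Dual ℂ (wtSpace σK (-c) (-d)) := (ψ ∘ₗ (wtSpace (σK.subrepresentation U hK) (-c) (-d)).subtype) ∘ₗ g
  refine ⟨(wtSpaceDualEquivOf hV c d (-c) (-d) rfl rfl).symm φ₀, LinearMap.ext fun u => ?_⟩
  rw [LinearMap.dualMap_apply, wtSpaceDualEquivOf_symm_apply, Submodule.coe_subtype]
  -- `pr^V_{(−c,−d)} u = r (pr^U_{(−c,−d)} u)`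
  have hpr : (⟨wtProj hV (-c, -d) (u : V), wtProj_mem hV (-c, -d) (u : V)⟩ : wtSpace σK (-c) (-d)) =
      r ⟨wtProj hU (-c, -d) u, wtProj_mem hU (-c, -d) u⟩ :=
    Subtype.ext (coe_wtProj_sub hV U hK hU (-c, -d) u).symm
  rw [hpr, show φ₀ (r _) = (ψ ∘ₗ (wtSpace (σK.subrepresentation U hK) (-c) (-d)).subtype) ((g ∘ₗ r) _) from rfl, hg,
    LinearMap.id_apply, LinearMap.comp_apply, Submodule.subtype_apply]
  -- `ψ (pr^U_{(−c,−d)} u) = ψ u` for a weight functional `ψ` of weight `(c,d)`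
  exact LinearMap.congr_fun (comp_wtProj_eq_self_of_mem hU rfl rfl hψ) u

/-! ## §3 `Ṽ → Ũ` is onto; the short exact sequence -/

/-- **`resCarrier : Ṽ → Ũ` is surjective** for every `(𝔤, K)`-module `V` of `U(1,1)` and every `(𝔤, K)`-stable `U ⊆ V` (weight vectors of
`Ũ` lift, §2, and `Ũ = ⨁ Ũ(c,d)`). [cite: KnappVogan1995, §II.3 Prop. 2.53 (b), §VI.2 (before (6.7))] [cite: BorelWallach2000, 0 §2.5] -/
theorem resCarrier_surjective : Function.Surjective (GKDual.resCarrier G11 σK U hK) := by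
  have hD := GKDual.isGKModule G11 _ _ hU
  rw [← LinearMap.range_eq_top, eq_top_iff, ← U11Weights.iSup_wtSpace_eq_top hD]
  refine iSup_le fun cd => fun x hx => ?_
  have hx' : ((x : GKDual.carrier G11 (σK.subrepresentation U hK)) : Dual ℂ U) ∈
      wtSpace (σK.subrepresentation U hK).dual cd.1 cd.2 :=
    (wtSpaceKfinEquiv (σK.subrepresentation U hK) cd.1 cd.2 ⟨x, hx⟩).2
  obtain ⟨ℓ, hℓ⟩ := exists_resCarrier_eq_of_mem_wtSpace hV U hK hU hx'
  exact ⟨⟨(ℓ : Dual ℂ V), mem_carrier_of_mem_wtSpace_dual σK ℓ.2⟩, Subtype.ext hℓ⟩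

/-- **`0 → (V/U)~ → Ṽ → Ũ → 0` is exact** («the contragredient functor is exact»): `infCarrier` is injective, the sequence is exact at
`Ṽ` (trunk, any `G`), and `resCarrier` is surjective (at `U(1,1)`). [cite: KnappVogan1995, §II.3 Prop. 2.53 (b), §VI.2 (before (6.7))]
[cite: BorelWallach2000, 0 §2.5] -/
theorem shortExact_infCarrier_resCarrier :
    Function.Injective (GKDual.infCarrier G11 σK U hK) ∧
      Function.Exact (GKDual.infCarrier G11 σK U hK) (GKDual.resCarrier G11 σK U hK) ∧
        Function.Surjective (GKDual.resCarrier G11 σK U hK) :=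
  ⟨GKDual.infCarrier_injective G11 σK U hK, GKDual.exact_infCarrier_resCarrier G11 σK U hK,
    resCarrier_surjective hV U hK hU⟩

end Sub

end U11DualWt

end Literature.RepresentationTheory.BorelWallach2000
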